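import Mathlib
import HarnessLib
import Summits.CriticalPhenomena.SAWScalingLimit.Theses.SAWDevelopingMap
import Literature.Probability.LatticeModels.TriangularLatticeProofs
import Literature.Probability.RandomPlanarGeometry.HexParafermionTransport
import Literature.Probability.RandomPlanarGeometry.HexDomainSingleton
import Literature.Barriers.CriticalPhenomena.ParafermionicHalfCauchyRiemann
import Summits.CriticalPhenomena.SAWScalingLimit.Theorems.SAWDevelopingMapInteriorFlatteningLiouvilleDefs
import Summits.CriticalPhenomena.SAWScalingLimit.Theorems.SAWDevelopingMapInteriorFlatteningLiouvilleLastExit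
import Summits.CriticalPhenomena.SAWScalingLimit.Theorems.SAWDevelopingMapInteriorFlatteningLiouvilleCompactness
import Summits.CriticalPhenomena.SAWScalingLimit.Theorems.SAWDevelopingMapInteriorFlatteningLiouvilleReduction
import Summits.CriticalPhenomena.SAWScalingLimit.Theorems.SAWDevelopingMapInteriorFlatteningLiouvilleNecessity
import Summits.CriticalPhenomena.SAWScalingLimit.Theorems.SAWDevelopingMapInteriorFlatteningLiouvilleEquivalence
import Summits.CriticalPhenomena.SAWScalingLimit.Theorems.SAWDevelopingMapInteriorFlatteningLiouvillePicSubLocal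
import Summits.CriticalPhenomena.SAWScalingLimit.Theorems.SAWDevelopingMapInteriorFlatteningLiouvilleIntrusionBridge
import Summits.CriticalPhenomena.SAWScalingLimit.Theorems.SAWDevelopingMapInteriorFlatteningCoherenceReduction
import Summits.CriticalPhenomena.SAWScalingLimit.Theorems.SAWDevelopingMapInteriorFlatteningFirstArrivalForm

/-!
# Line `liouville-local-limits` — skeleton for crux `InteriorFlattening`
(stmt-CriticalPhenomena-8297, route `SAWDevelopingMap`, rank 3)

The crux `(M)`: for every `ε > 0` there is a depth `R` such that at every vertex `v` of every
simply connected hexagonal domain `Λ` whose Euclidean `R`-ball of lattice vertices lies in `Λ`,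
for every boundary root `a` and every labelling `w₀ w₁ w₂` of the three neighbours of `v`, the
DCS observable `F = F(a, ·, x_c, 5/8)` satisfies `‖F₀ + ωF₁ + ω²F₂‖ ≤ ε ‖F₀ + F₁ + F₂‖`.

THE LINE (idea card `Ideas/liouville-local-limits.md`, ideator 1; triage r1-1 pass, r1-2 fail,
r1-3 pass; sharpened as the three triagers asked: the class `𝓕` is TYPED (`LocalLimits`), its
renewal-closure is the first real stub (`stub_lastExitFactorisation`, exact and provable), and
the rigidity input that affine-alias fields violate is NAMED — it is LOSS OF MEMORY plus the exact
`120°` covariance of the honeycomb, not a flux identity and not an extremal argument).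

* HEXAGONAL RIGIDITY ONE LEVEL DOWN. Under an eventual bulk no-fold bound (`stub_bulkNoFold`, the
  route's (K) restricted to deep vertices and to SOME `k < 1`; implied by `NoFoldBound` and by the
  crux itself, both proved below) the `M(O)`-normalised observables recentred at a deep vertex are
  precompact (lattice Harnack, `noFoldHarnack` proved below, chained), so a failure of (M) along
  deeper and deeper vertices produces an entire lattice field `G ∈ LocalLimits` that is NOT flat at
  the origin vertex `O` — together with its rotated companion `G ∘ rot`, because the class of local
  limits is closed under the rotation by `120°` about the centre of `O` (`stub_compactnessAtOrigin`,
  provable: transport by lattice symmetries + diagonal extraction).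
* LIOUVILLE, ORIENTATION-FREE. The crux is then equivalent (given bulk no-fold) to
  `LocalLimits.Subsingleton`: ALL deep configurations induce the SAME normalised lattice-scale
  field near a deep vertex — the far field `(Λ, a)` is forgotten. Flatness is not estimated, it
  drops out of symmetry: a unique limit equals its own rotation, so its three values around `O`
  coincide (`InteriorFlattening_of`, proved). The affine-alias enemy `A + C e^{-2iθ}` (triage (c))
  is Lemma-1-closed and no-fold but NOT rotation invariant, so it can be a local limit only if the
  far field is remembered at lattice scale at all depths.
* LOSS OF MEMORY is reduced to an explicit sub-family plus two far-field bets, by the exact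
  LAST-EXIT FACTORISATION at one scale `S` (`stub_lastExitFactorisation`): every walk to an edge of
  the lattice ball `B_S(O)` is (prefix up to its last vertex outside `B_S`) × (a walk of the
  PICTURE DOMAIN `B_S ∖ intrusions` from the entrance dart), pictures `P = (intrusion set, dart)`
  forming a finite universal index set `Pic S`; so `F|_{B_S} = Σ_P amp(P) · F_P`, with `F_P` the
  observable of a domain that involves NO far field. Then
  `LocalLimits.Subsingleton ⇐ PicLimits.Subsingleton ∧ FarFieldCoherence ∧ IntrusionTail`
  (`stub_uniquenessReduction`, provable: compactness turns qualitative uniqueness on the sub-family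
  into uniform convergence of clean rows; coherence and the tail make the complex superposition
  inherit it), where
  - `stub_pictureLimitsUnique` (THE CORE, hardest): local limits at the centre of large picture
    domains (lattice ball minus boundary-hanging arcs, dart root on the sphere, cleanliness radius
    → ∞) are unique — the qualitative, orientation-free form of "balls flatten";
  - `stub_farFieldCoherence` (bet shared with the sibling lines): `Σ_P |amp(P)| |m(P)| ≤ K |M|`;
  - `stub_intrusionTail` (3-arm bet shared with the sibling lines): prefixes that dived near `O`
    before their last entrance carry a vanishing share.

Composition `InteriorFlattening_of : S1 → … → S7 → InteriorFlattening` is proved below (no `sorry`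
outside the seven `stub_*`). Everything in the skeleton is implied by the crux (S1 at `ε = 1/2`,
uniqueness from flatness of all limits), so the line loses nothing: given the provable stubs,
`crux ⟺ S1 ∧ S4 ∧ (S5, S6 only through S7)`.

RESHAPE r1–r4 (lead `prover-line-stmt-CriticalPhenomena-8297-c1-0`, 2026-08-16; r2 adds `p ∈ D → q ∈ D →`
to S4, all that S7 uses, making S4 a re-indexing of the landed one-mouth factorisation; r3 spells the
hypotheses of S7 out so that every stub is stated over the Defs objects only; r4 normalises S6' by
`Σ|amp||m|` instead of `|M(O)|`): the two far-field
bets S6/S6' are WINDOWED (`B_{2S}(O) ⊆ Λ ⊉ B_{4S}(O)` replaces `Deep Λ O (S+2)`): at fixed cut scale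
`S` with depth `→ ∞` the conditional outer sheet sum given the entry position is dominated by its
spin `-3/8` harmonic (`Ĝ(σ-1)` vs `Ĝ(σ)`), so `Σ_P |amp||m| / |M| ≍ (depth/S)^{1/3} → ∞` — the
unwindowed statements were false (card's "dead variant" bookkeeping; gen-0 numerics
`Â ∝ (depth/r)^{0.45–0.53}` on the sibling line). S7 picks the window scale per configuration
(`exists_window`, landed in `…OneScaleGlue`); the composition is unchanged. Objects are shared with
the Theorems-side Defs module `…Theorems.SAWDevelopingMapInteriorFlatteningLiouvilleDefs` (proposed;
this file's local copies are byte-identical and are replaced by the import once it lands).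

STATE r8 (lead `prover-line-stmt-CriticalPhenomena-8297-c2-0`, cycle 2, 2026-08-16): S2
`stub_compactnessAtOrigin` (…LiouvilleCompactness, p111048), S4 `stub_lastExitFactorisation`
(…LiouvilleLastExit, p104482) and S7 `stub_uniquenessReduction` (…LiouvilleReduction, p110977) are
CLOSED in the tree and discharged inside `InteriorFlattening_of`; the open stubs are S1 `stub_bulkNoFold`
(⇐ `NoFoldBound`, stmt-CriticalPhenomena-8296), S5 `stub_pictureLimitsUnique` (the core), S6
`stub_farFieldCoherence`, S6' `stub_intrusionTail`. With S2 and Necessity (p103986) the landed pieces give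
the exact reformulation `InteriorFlattening ⟺ BulkNoFold ∧ LocalLimits.Subsingleton` (…LiouvilleEquivalence).

RESHAPE r9 (lead `prover-line-stmt-CriticalPhenomena-8297-c3-0`, cycle 3, 2026-08-16): the TOP LAYER of the skeleton is
now the necessary-and-sufficient pair {S1 `stub_bulkNoFold`, S5* `stub_localLimitsUnique`} — `InteriorFlattening_of h1 h5*`
is the landed Equivalence (p115301) read left to right, and `interiorFlattening_iff_registered` records in the skeleton
itself that NOTHING is lost (`crux ⟺ S1 ∧ S5*`, both conjuncts implied by the crux: `bulkNoFold_of_interiorFlattening`,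
`localLimitsUnique_of_interiorFlattening`). The factorisation sub-route of r1–r8 is kept, registered, one layer down:
`localLimitsUnique_of_subroute : S5 → S6 → S6' → S5*` is S4 + S7 (landed), so `InteriorFlattening_of_subroute h1 h5 h6 h6'`
is r8's composition verbatim. Of the five registered stubs S1, S5*, S5 are NECESSARY (`…_of_interiorFlattening` below);
S6, S6' are the only bets (windowed far-field transfer) and serve only to carry S5 up to S5*.
STATE r9b (same lead, after wave 3): S5\* ⟹ S5 is LANDED (`pictureLimitsUnique_of_localLimitsUnique`, …LiouvillePicSubLocal,
p117666: `PicLimits ⊆ LocalLimits`), so the sub-route is a way of proving S5\*, never a weakening; the two bets are reduced to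
NAMED ATOMS by landed bridges recorded below: S6 ⇐ `OneMouth.PhaseConcentration η β` (PC; `farFieldCoherence_of_PC` =
CoherenceReduction + CoherenceBridge p107715; wave-3 verdict stub-blocked on PC, windowed amplification 1.3–2.0 and NOT
growing with S at fixed R/S — S6 worker's exact enumeration), S6' ⇐ `PictureReentryGap ρ` (E1', new atom) +
`OneMouth.CleanMonopoleLowerBound κ` (E2), `κ < ρ` (`intrusionTail_of_atoms` = …LiouvilleIntrusionBridge p117719, wave-3
verdict stub-blocked). None of PC, E1', E2 is a published result.
STATE r9c (same lead): the crux is recorded IN FIRST-ARRIVAL FORM (`interiorFlattening_iff_firstArrival`, from the landed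
…FirstArrivalForm p118929 and the Literature mode identities HexSAWModes p117943 / HexParafermionModes p118439 /
HexParafermionModeIdentities p118819, all from this line): at every deep vertex, in every clockwise frame,
`‖κ_B (A₀ + ωA₁ + ω²A₂) + (L₀ + ωL₁ + ω²L₂)‖ ≤ ε ‖κ_M (A₀ + A₁ + A₂) + (L₀ + L₁ + L₂)‖` with `A_j` the FIRST ARRIVALS at `{v, w_j}`
(from `w_j`, `v` unvisited), `L_j` the loop walks, `κ_B = 1 + 2x_c cos(11π/24) = 1.1413…`, `κ_M = 1 + 2x_c cos(5π/24) = 1.8587…`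
— the object S5\* must control is ONE family of positive-weight walk classes per vertex.
STATE r9d (same lead, end of cycle 3): the two-character form is a theorem of the tree end to end — Literature `HexSAWTurnLaw`
(p119280: direction = entrance·ω^{pturn}; `turnMass ≥ 0`; the first arrivals' sum / conjugate-direction modes are the `λ`- and
`λ·omg⁻¹`-characters of ONE non-negative law) and `HexParafermionTurnLaw` (p130377: `firstArrival_modes_eq_characters`, at the level of
`hexParafermionicObservable`, with a unit constant). NUMERICS of the cycle (ANALYSIS_c3.md on the item; kit j019170/j019171, own
enumerator + MC validated against exact values): at lattice-ball centres the worst (head-on) root gives `|μ| = 0.683 R^{-0.760}` for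
`R = 12…96` (χ²/dof 0.7/5); BOTH root classes are `0.37 R^{-2/3} ± 0.35 R^{-1}` (same leading coefficient, opposite sub-leading sign: the
two continuum aliases `s ≡ -11/8 (mod 3)` of the `165°`/class character), so the rate is `R^{-2/3}` and `R(ε) ≍ (0.37/ε)^{3/2}`; the class-law
variance is `0.609 ln R + 0.04 = κ/(2π/3)² ln R`, `κ = 8/3`, to three digits; re-entrant prefixes carry 1–3 % of the Beltrami mode; and over
45 adversarial simply connected far fields at depth 4/8/16 the supremum of `|μ|` is the plain ball (amplification ≤ 1.01). Nothing here is a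
proof; it says S5\* (and the uniform crux) is numerically TRUE with rate `R^{-2/3}`, and that no line can close it with known mathematics.
STATE r10 (lead `prover-line-stmt-CriticalPhenomena-8297-c4-0`, cycle 4, 2026-08-17): no stub moved and none can with known
mathematics (waves 1–3: S1 ⇐ stmt-8296; S6 ⇐ PC; S6' ⇐ E1'+E2; S5 ⇐ S5\*; S5\* research-open); the cycle's Lean content is the
PROMOTION PACKAGE `…LiouvillePromotion` (p133334): the open core S5\* in the ROUTE FILE'S OWN VOCABULARY, recorded in this
skeleton (proof terms inlined; swap for the import once farm snapshots carry the module) as `registered_core_iff_conditional : stub_localLimitsUnique ↔ (stub_bulkNoFold → crux)`,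
`registered_core_iff_routeVocabulary` (the pasteable signature: an eventual no-fold bound, spelled out over
`hexParafermionicObservable`, implies `InteriorFlattening`) and `transfer_iff_subsingleton`
(`(NoFoldBound → InteriorFlattening) ↔ (NoFoldBound → LocalLimits.Subsingleton)`): the planner can promote S5\* to an
item, or replace the crux by the transfer statement `NoFoldBound → InteriorFlattening` in `closes` (which already binds
`NoFoldBound`), without importing this line's Defs and without any new definition. Literature re-checked 2026-08-17
(OpenAlex/arXiv 2019–2026: no result on orientation-independence / full discrete Cauchy–Riemann for the SAW observable;
nearest new neighbour is Ising-side, Mahfouf arXiv:2512.20361, planar Ising → quasiconformal maps, where s-holomorphicity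
is exact).

Disproof honoured (`Cruxes/InteriorFlattening/Disproof.lean`, gen 2): (A) depth load-bearing —
every class here is built from `n`-deep configurations (`Adm n`), the singleton witness is never
an instance; quantifier order — `RatioAtDepth R η` keeps `∀ (Λ,a,v)` inside; simple connectivity —
a hypothesis of every admissible configuration AND of every picture domain entering `PicLimits`
(holed picture domains are interferometers, §A/§3 and `noFoldBound_false_without_simplyConnected`);
(B) kernel blindness — nothing is derived from vertex relations: Lemma 1 enters only the Harnack
inversion, the content is loss of memory of WALK sums (factorisation is a bijection of walks);
(C1) no port statement anywhere; (D) `M(O) ≠ 0` is forced at bad vertices by S1, never assumed.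
-/

namespace Summit.CriticalPhenomena.SAWScalingLimit.Cruxes.InteriorFlattening.LiouvilleLocalLimits

open scoped BigOperators Classical Topology
open Filter Literature.Probability.LatticeModels Literature.Probability.RandomPlanarGeometry.SAW
open Summit.CriticalPhenomena.SAWScalingLimit.Theorems.InteriorFlattening.Liouville
open Summit.CriticalPhenomena.SAWScalingLimit.Theorems.InteriorFlattening (OneMouth.PhaseConcentration
  OneMouth.CleanMonopoleLowerBound OneMouth.farFieldCoherence_of_phaseConcentration)

noncomputable section

/-! ### Objects: imported from `…Theorems.SAWDevelopingMapInteriorFlatteningLiouvilleDefs` (namespace opened above) -/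

/-- READ-BACK: the crux is `∀ ε > 0, ∃ R, RatioAtDepth R ε`, definitionally. -/
theorem interiorFlattening_iff :
    Summit.CriticalPhenomena.SAWScalingLimit.Theses.SAWDevelopingMap.InteriorFlattening ↔
      ∀ ε : ℝ, 0 < ε → ∃ R : ℝ, RatioAtDepth R ε :=
  Iff.rfl

/-! ### The origin vertex, its star, the `120°` rotation -/

theorem rotO_O : rotO O = O := by
  unfold rotO O
  refine Prod.ext ?_ rfl
  ext i; fin_cases i <;> simp [triRot60]

theorem rotO_nbA : rotO nbA = nbB := by
  unfold rotO nbA nbB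
  refine Prod.ext ?_ rfl
  ext i; fin_cases i <;> simp [triRot60]

theorem rotO_nbB : rotO nbB = nbC := by
  unfold rotO nbB nbC
  refine Prod.ext ?_ rfl
  ext i; fin_cases i <;> simp [triRot60]

theorem rotO_nbC : rotO nbC = nbA := by
  unfold rotO nbC nbA
  refine Prod.ext ?_ rfl
  ext i; fin_cases i <;> simp [triRot60]

/-- The three neighbours of `O` are `A, B, C`. -/
theorem nbr_cases {w : HexVertex} (h : hexGraph.Adj O w) : w = nbA ∨ w = nbB ∨ w = nbC := by
  obtain ⟨y, k⟩ := w
  fin_cases k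
  · exact absurd h (not_hexGraph_adj_of_snd_eq_holds _ _ rfl)
  · rcases (hexGraph_adj_iff_of_snd_eq_zero_holds 0 y).1 h with rfl | rfl | rfl
    · exact Or.inl rfl
    · refine Or.inr (Or.inl ?_); simp [nbB]
    · refine Or.inr (Or.inr ?_); simp [nbC]

/-- `ω = ζ²` (`ζ = e^{iπ/3}` of the triangular lattice). -/
theorem omega_eq_triZeta_sq : omega = triZeta ^ 2 := by
  rw [omega, triZeta, sq, ← Complex.exp_add]
  congr 1
  ring

/-- `1 + ω + ω² = 0`. -/
theorem one_add_omega_add_sq : 1 + omega + omega ^ 2 = 0 := by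
  rw [omega_eq_triZeta_sq]
  have hz : triZeta ^ 2 = triZeta - 1 := by rw [HV.triZeta_eq_omg]; exact HV.omg_sq
  linear_combination (triZeta ^ 2 + triZeta + 1) * hz

/-- `ω³ = 1`. -/
theorem omega_pow_three : omega ^ 3 = 1 := by
  rw [omega_eq_triZeta_sq, HV.triZeta_eq_omg, ← pow_mul,
    show 2 * 3 = 3 * 2 by norm_num, pow_mul, HV.omg_pow_three]
  norm_num

/-- `‖ω‖ = 1`. -/
theorem norm_omega : ‖omega‖ = 1 := by
  have : omega = Complex.exp ((2 * Real.pi / 3 : ℝ) * Complex.I) := by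
    unfold omega; congr 1; push_cast; ring
  rw [this, Complex.norm_exp_ofReal_mul_I]

/-! ### Proved: the card's First lemma — lattice Harnack from no-fold (`NoFoldHarnack`) -/

/-- **Lattice Harnack from no-fold** (card `liouville-local-limits`, First lemma; triage r1-1/2/3:
"right"). For ANY lattice field, at a vertex where the DCS mode vanishes (`D = 0`, Lemma 1 for the
observable) and the Beltrami quotient is `≤ k < 1`, adjacent mid-edge moduli are comparable with
the quasiconformal constant `K = (1+k)/(1-k)`: inverse `ℤ/3`-Fourier transform
`3F₀ = M + B`, `3F₁ = M + ω²B`. Chained along deep vertices it gives local boundedness of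
`M(O)`-normalised fields — the compactness inside `stub_compactnessAtOrigin`. -/
theorem noFoldHarnack (k : ℝ) (hk0 : 0 ≤ k) (hk1 : k < 1) (G : Sym2 HexVertex → ℂ)
    (v w₀ w₁ w₂ : HexVertex)
    (hD : G s(v, w₀) + omega ^ 2 * G s(v, w₁) + omega * G s(v, w₂) = 0)
    (hB : ‖fieldBelt G v w₀ w₁ w₂‖ ≤ k * ‖fieldMono G v w₀ w₁ w₂‖) :
    ‖G s(v, w₀)‖ ≤ (1 + k) / (1 - k) * ‖G s(v, w₁)‖ := by
  set F0 := G s(v, w₀) with hF0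
  set F1 := G s(v, w₁) with hF1
  set F2 := G s(v, w₂) with hF2
  have hM : fieldMono G v w₀ w₁ w₂ = F0 + F1 + F2 := rfl
  have hBd : fieldBelt G v w₀ w₁ w₂ = F0 + omega * F1 + omega ^ 2 * F2 := rfl
  set M := fieldMono G v w₀ w₁ w₂
  set B := fieldBelt G v w₀ w₁ w₂
  have h1 := one_add_omega_add_sq
  have h3 := omega_pow_three
  -- inverse ℤ/3-DFT
  have e0 : (3 : ℂ) * F0 = M + B := by
    rw [hM, hBd]; linear_combination hD - (F1 + F2) * h1
  have e1 : (3 : ℂ) * F1 = M + omega ^ 2 * B := by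
    rw [hM, hBd]
    linear_combination (-(1 + omega ^ 2)) * hD + F1 * h1 + (omega - 1) * (F1 - F2) * h3
  -- norms
  have hω2 : ‖omega ^ 2‖ = 1 := by rw [norm_pow, norm_omega, one_pow]
  have h3n : ‖(3 : ℂ)‖ = 3 := by norm_num
  have n0 : 3 * ‖F0‖ ≤ ‖M‖ + ‖B‖ := by
    calc 3 * ‖F0‖ = ‖(3 : ℂ) * F0‖ := by rw [norm_mul, h3n]
      _ = ‖M + B‖ := by rw [e0]
      _ ≤ ‖M‖ + ‖B‖ := norm_add_le _ _
  have n1 : ‖M‖ ≤ 3 * ‖F1‖ + ‖B‖ := by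
    have hMeq : M = 3 * F1 - omega ^ 2 * B := by linear_combination (-1 : ℂ) * e1
    calc ‖M‖ = ‖(3 : ℂ) * F1 - omega ^ 2 * B‖ := by rw [← hMeq]
      _ ≤ ‖(3 : ℂ) * F1‖ + ‖omega ^ 2 * B‖ := norm_sub_le _ _
      _ = 3 * ‖F1‖ + ‖B‖ := by rw [norm_mul, norm_mul, h3n, hω2, one_mul]
  have h1k : 0 < 1 - k := by linarith
  have hA : 3 * ‖F0‖ ≤ (1 + k) * ‖M‖ := by linarith
  have hBf : (1 - k) * ‖M‖ ≤ 3 * ‖F1‖ := by linarith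
  have step1 : 3 * ‖F0‖ * (1 - k) ≤ (1 + k) * ‖M‖ * (1 - k) :=
    mul_le_mul_of_nonneg_right hA h1k.le
  have step2 : (1 + k) * ((1 - k) * ‖M‖) ≤ (1 + k) * (3 * ‖F1‖) :=
    mul_le_mul_of_nonneg_left hBf (by linarith)
  rw [div_mul_eq_mul_div, le_div_iff₀ h1k]
  linarith [step1, step2]

/-! ### The seven statements of the line, as named propositions -/

/-- **S1 — eventual bulk no-fold** ((K)-lite): some `k < 1` bounds the Beltrami quotient at every
`R₀`-deep vertex of every admissible configuration. Implied by the route's `NoFoldBound`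
(`bulkNoFold_of_noFoldBound`) and by the crux itself (`bulkNoFold_of_interiorFlattening`). -/
def BulkNoFold : Prop :=
  ∃ k R₀ : ℝ, 0 ≤ k ∧ k < 1 ∧ RatioAtDepth R₀ k

/-- **S2 — compactness and covariance at the origin**: under bulk no-fold, if the crux fails at
tolerance `ε` at every depth, some local limit `G` is `ε`-bad at `O` (in some frame), normalised
(`M_G(O) = 1`), and its rotation `G ∘ rot` is again a local limit. -/
def CompactnessAtOrigin : Prop :=
  ∀ (k R₀ ε : ℝ), 0 ≤ k → k < 1 → RatioAtDepth R₀ k → 0 < ε → (∀ n : ℕ, ¬ RatioAtDepth n ε) →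
    ∃ G : Sym2 HexVertex → ℂ, G ∈ LocalLimits ∧ (G ∘ Sym2.map rotO) ∈ LocalLimits ∧
      fieldMono G O nbA nbB nbC = 1 ∧
      ∃ w₀ w₁ w₂ : HexVertex, hexGraph.Adj O w₀ ∧ hexGraph.Adj O w₁ ∧ hexGraph.Adj O w₂ ∧
        w₀ ≠ w₁ ∧ w₁ ≠ w₂ ∧ w₀ ≠ w₂ ∧
        ε * ‖fieldMono G O w₀ w₁ w₂‖ ≤ ‖fieldBelt G O w₀ w₁ w₂‖

/-- **S4 — last-exit factorisation at one scale** (exact renewal-closure): for a root outside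
`B_S(O)` and a target pair inside (both endpoints in the domain — all S7 needs; reshape r2, so
that S4 is a re-indexing of the landed `…OneMouth.stub_factorisation`), the observable is the
finite superposition, over all pictures,
of prefix amplitude × observable of the picture domain from the dart (unrealised pictures have
amplitude `0`; a dart head inside the intrusion set makes the inner observable `0`). -/
def LastExitFactorisation : Prop :=
  ∀ (D : Finset HexVertex) (ρ : Sym2 HexVertex) (S : ℝ) (p q : HexVertex),
    (∀ u ∈ ρ, u ∉ latticeBall S) → p ∈ latticeBall S → q ∈ latticeBall S → p ∈ D → q ∈ D →
      obs D ρ s(p, q) = ∑ P ∈ Pic S, amp D ρ S P * obs (picDom D S P) (picRoot P) s(p, q)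

/-- **S5 — uniqueness of picture limits** (THE CORE; Liouville for the sub-family). -/
def PictureLimitsUnique : Prop :=
  ∀ k R₀ : ℝ, 0 ≤ k → k < 1 → RatioAtDepth R₀ k → PicLimits.Subsingleton

/-- **S5\* — uniqueness of ALL lattice-scale local limits** (Liouville; the crux's exact content modulo S1,
by the landed Equivalence `interiorFlattening_iff_bulkNoFold_and_subsingleton`): under bulk no-fold, all
pointwise limits of `M(O)`-normalised observables of admissible configurations of depth `→ ∞` coincide —
the far field `(Λ, a)` is forgotten at lattice scale near a deep vertex. NECESSARY for the crux
(`localLimitsUnique_of_interiorFlattening`, from …LiouvilleNecessity: under (M) every local limit is the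
constant field `1/3`), and with S1 SUFFICIENT (`InteriorFlattening_of`). The sub-route S4+S5+S6+S6' ⟹ S5\* is S7. -/
def LocalLimitsUnique : Prop :=
  ∀ k R₀ : ℝ, 0 ≤ k → k < 1 → RatioAtDepth R₀ k → LocalLimits.Subsingleton

/-- **S6 — WINDOWED far-field coherence**: the complex numbers `amp(P) · m(P)` do not cancel
across pictures, uniformly over admissible configurations whose depth at `O` is COMPARABLE to the
cut scale (`B_{2S}(O) ⊆ Λ ⊉ B_{4S}(O)`): `Σ_P |amp(P)| |m(P)| ≤ K |M(O)|`. (Reshape r1 of the lead: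
the planner's unwindowed form `Deep Λ O (S+2)` with depth `→ ∞` at fixed `S` is FALSE — the entry
POSITION conditions the outer sheet sum to its spin `-3/8` harmonic, of relative size
`(depth/S)^{1/3} → ∞`; this is the card's own "dead variant" bookkeeping and the gen-0 lead's
numerics `Â ∝ (depth/r)^{0.45–0.53}` for the sibling line's unwindowed S3. With the window the
winding accumulated outside `4S` is blocked by the wall reaching `B_{4S}(O)` and `K = O(1)` is the
one-scale bet, exactly the sibling line's surviving S3'.) -/
def FarFieldCoherence : Prop :=
  ∃ K S₁ : ℝ, ∀ S : ℝ, S₁ ≤ S → ∀ (Λ : Finset HexVertex) (a : Sym2 HexVertex),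
    hexDomainSimplyConnected Λ → a ∈ hexDomainBoundary Λ → Deep Λ O (2 * S) → ¬ Deep Λ O (4 * S) →
      ∑ P ∈ Pic S, ‖amp Λ a S P‖ * ‖picMono S P‖ ≤ K * ‖obsMono Λ a‖

/-- **S6' — WINDOWED intrusion tail**: in the same window (`B_{2S}(O) ⊆ Λ ⊉ B_{4S}(O)`),
prefixes whose intrusions reach `B_{s̄}(O)` (deep dives before the last entrance) carry, against
the inner fields on `B_r(O)`, a share `≤ δ Σ_P |amp(P)||m(P)|` of the coherent-weight total once
`S` is large (reshape r4: normalised by `N = Σ|amp||m|`, not by `|M(O)|`, so that the statement is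
immune to a hypothetical exact monopole zero; S7 converts with S6: `N ≤ K|M|`). (Reshape r1:
windowed for the same reason as S6.) -/
def IntrusionTail : Prop :=
  ∀ r : ℝ, 1 ≤ r → ∀ sbar : ℝ, r ≤ sbar → ∀ δ : ℝ, 0 < δ → ∃ S₂ : ℝ, ∀ S : ℝ, S₂ ≤ S →
    ∀ (Λ : Finset HexVertex) (a : Sym2 HexVertex),
      hexDomainSimplyConnected Λ → a ∈ hexDomainBoundary Λ → Deep Λ O (2 * S) → ¬ Deep Λ O (4 * S) →
        ∑ P ∈ (Pic S).filter (fun P => ¬ Clean sbar P),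
            ‖amp Λ a S P‖ * ∑ e ∈ innerEdges r, ‖picField S P e‖ ≤
          δ * ∑ P ∈ Pic S, ‖amp Λ a S P‖ * ‖picMono S P‖

/-- **S7 — the uniqueness reduction**: factorisation + coherence + tail transfer uniqueness of
local limits from the sub-family of picture domains to all admissible configurations (under bulk
no-fold, which makes normalised clean rows precompact and either alive or dead near `O`). -/
def UniquenessReduction : Prop :=
  LastExitFactorisation → FarFieldCoherence → IntrusionTail →
    ∀ k R₀ : ℝ, 0 ≤ k → k < 1 → RatioAtDepth R₀ k → PicLimits.Subsingleton →
      LocalLimits.Subsingleton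

/-! ### The stubs (registered; signatures spelled out, definitionally the named statements) -/

/-- **S1 — eventual bulk no-fold (base; (K)-lite).** Some `k < 1` and depth `R₀` such that at
every `R₀`-deep vertex `v` of every simply connected domain with a boundary root, and every frame,
`‖F₀ + ωF₁ + ω²F₂‖ ≤ k ‖F₀ + F₁ + F₂‖`. Strictly weaker than the route's rank-2 crux
`NoFoldBound` (all vertices, incl. the root where `sup |μ| ≥ 0.686`): here only deep vertices,
where all data give `|μ| ≤ 0.42`; any `k < 1` will do. Needed for two-sided lattice Harnack
(`noFoldHarnack`), i.e. precompactness and non-degeneracy (`M ≠ 0` at bad vertices) of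
normalised local fields. A consequence of the crux (`ε = 1/2`). -/
theorem stub_bulkNoFold :
    ∃ k R₀ : ℝ, 0 ≤ k ∧ k < 1 ∧ RatioAtDepth R₀ k := by
  sorry

/-- **S2 — compactness and covariance at the origin (provable now, L).** Transport each bad
configuration (depth `n`, tolerance `ε`) to the origin by a translation (composed with the central
flip `z ↦ -z + β` for down triangles) — graph automorphisms acting by complex-affine maps, under
which domains stay simply connected, roots stay boundary roots, balls stay balls, and the
observable is invariant (lengths and geometric windings are intrinsic: `HV.turning_affine`,
`winding_map_affine`); normalise by `M(O) ≠ 0` (forced by no-fold at a bad vertex once `n ≥ R₀`);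
bound every coordinate `F(z)/M(O)` by `K^{O(dist)}`, `K = (1+k)/(1-k)`, chaining `noFoldHarnack`
(Lemma 1 `DuminilCopinSmirnov2012_lemma1_holds` supplies `D = 0` at deep vertices); extract a
diagonal subsequence converging on the countable edge set (closed discs are compact); one of the
six frames is bad infinitely often; normalisation, badness (a closed condition) and the off-edge
convention pass to the limit. The rotated sequence `(rot⁻¹ Λₙ, rot⁻¹ aₙ)` is admissible with the
same monopole at `O` (the rotation permutes the star of `O`) and converges to `G ∘ rot`. -/
theorem stub_compactnessAtOrigin :
    ∀ (k R₀ ε : ℝ), 0 ≤ k → k < 1 → RatioAtDepth R₀ k → 0 < ε → (∀ n : ℕ, ¬ RatioAtDepth n ε) →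
      ∃ G : Sym2 HexVertex → ℂ, G ∈ LocalLimits ∧ (G ∘ Sym2.map rotO) ∈ LocalLimits ∧
        fieldMono G O nbA nbB nbC = 1 ∧
        ∃ w₀ w₁ w₂ : HexVertex, hexGraph.Adj O w₀ ∧ hexGraph.Adj O w₁ ∧ hexGraph.Adj O w₂ ∧
          w₀ ≠ w₁ ∧ w₁ ≠ w₂ ∧ w₀ ≠ w₂ ∧
          ε * ‖fieldMono G O w₀ w₁ w₂‖ ≤ ‖fieldBelt G O w₀ w₁ w₂‖ :=
  _root_.Summit.CriticalPhenomena.SAWScalingLimit.Theorems.InteriorFlattening.Liouville.stub_compactnessAtOrigin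

/-- **S4 — last-exit factorisation (provable now, L; the renewal-closure the triage asked for,
made exact).** Cut every walk `ρ → s(p,q)` (`p, q ∈ B_S(O) ∩ D`, root outside) at its LAST vertex `y`
outside `B_S(O)`: the prefix `ψ : ρ → mid(y,z)` arrives from `y`, the remainder is a walk of the
picture domain `(D ∩ B_S) ∖ (ψ.verts ∩ B_S)` from `mid(y,z)` (it stays in the ball and avoids
the prefix); weights multiply (lengths add; windings add at the junction mid-edge, which lies on
the segment `c_y c_z`: `turning_right_ray`/`turning_left_ray`, `winding_append_cons_cons`);
conversely every (prefix, inner walk) pair concatenates to a self-avoiding walk of `D` with that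
picture (the inner walk avoids the prefix: inside the ball by construction, outside because it
never leaves the ball; no edge is re-used; the junction dart is not the root since its head lies
in the ball). A finite bijection of walks — pure combinatorics, no topology, no estimate. -/
theorem stub_lastExitFactorisation :
    ∀ (D : Finset HexVertex) (ρ : Sym2 HexVertex) (S : ℝ) (p q : HexVertex),
      (∀ u ∈ ρ, u ∉ latticeBall S) → p ∈ latticeBall S → q ∈ latticeBall S → p ∈ D → q ∈ D →
        obs D ρ s(p, q) = ∑ P ∈ Pic S, amp D ρ S P * obs (picDom D S P) (picRoot P) s(p, q) :=
  _root_.Summit.CriticalPhenomena.SAWScalingLimit.Theorems.InteriorFlattening.Liouville.stub_lastExitFactorisation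

/-- **S5 — uniqueness of picture limits (OPEN; THE CORE; hardest).** Under bulk no-fold, all
local limits at the centre of large good picture domains — lattice balls `B_{S_n}(O)` minus
boundary-hanging arcs, rooted at a dart of the sphere, cleanliness radius `≥ n` — coincide.
Orientation-free: no `ω`, no Beltrami mode, no `ε/R`; by `rot`-covariance of the family (exact)
the unique limit is then flat, and conversely the crux forces every picture limit to be the
constant field `1/3` on edges, so S5 is implied by the crux. It is the qualitative twin of the
sibling line's `oneMouthBallFlattening`, with flatness replaced by forgetting. What must die is
the memory, at lattice scale near `O`, of the direction of the root dart and of the shape of the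
receding arcs — heuristically `O(1/S_n) + O(1/n)` (Koebe distortion of `(φ')^{5/8}` plus the
lattice alias), but only convergence to SOME common field is asked. -/
theorem stub_pictureLimitsUnique :
    ∀ k R₀ : ℝ, 0 ≤ k → k < 1 → RatioAtDepth R₀ k → PicLimits.Subsingleton := by
  sorry

/-- **S5\* — uniqueness of local limits (OPEN; the crux modulo S1; held by the lead).** Under bulk
no-fold, `LocalLimits` is a subsingleton: every two pointwise limits of `M(O)`-normalised DCS observables
of admissible configurations (simply connected, boundary root, `O` `n`-deep, `n → ∞`) coincide on every
edge. In the two-character form of the line's analysis: at a deep vertex the Beltrami quotient is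
`|μ_v| = (κ_B/κ_S) · |ô(165°)| / |ô(75°)|` up to the through-`v` correction, `κ_B/κ_S = 0.614`, where
`o_m ≥ 0` is the `x_c`-mass of FIRST arrivals at the star of `v` with winding class `m ∈ ℤ` (unit `120°`:
`m mod 3` = port) and `ô(φ) = Σ_m o_m e^{iφm}`; uniqueness of the local limit is the statement that this
positive law, normalised, forgets the far field — equivalently (given S1 and `rot`-covariance) that its
`165°`-character is `o(1)` of its `75°`-character as the depth grows. No published result controls it
(DCS 2012 p. 7: "we expect that in the limit the curl vanishes"); numerics: `|μ| = 0.40 … 0.070` at ball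
centres `R = 2 … 20`, far-field amplification `≤ 1.09` in `> 1500` simply connected instances. -/
theorem stub_localLimitsUnique :
    ∀ k R₀ : ℝ, 0 ≤ k → k < 1 → RatioAtDepth R₀ k → LocalLimits.Subsingleton := by
  sorry

/-- **S6 — windowed far-field coherence (OPEN; the bet shared with `z3-covariant-fixed-point` S3
and `one-mouth-ball-reduction` S3').** `Σ_{P ∈ Pic S} |amp(P)| · |m_S(P)| ≤ K |M(O)|` uniformly over
admissible configurations IN THE WINDOW `B_{2S}(O) ⊆ Λ ⊉ B_{4S}(O)` and scales `S ≥ S₁` (reshape r1: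
the unwindowed form is false, ratio `≍ (depth/S)^{1/3}`; see `FarFieldCoherence`). Mechanism: the total winding from the root to
a star edge does not depend on the entrance dart, so the phase of `amp(P) m_S(P)` varies across
pictures only through the (weak) correlation between outer and inner sheet numbers given the cut;
false with a hole (two routes: amplification `2+√3`, Disproof §A; 12-ring `2.29`,
`noFoldBound_false_without_simplyConnected`); triage data on 780 + 694 simply connected far
fields: amplification of `μ` ≤ 1.09. It also yields `M(O) ≠ 0` whenever one product is non-zero. -/
theorem stub_farFieldCoherence :
    ∃ K S₁ : ℝ, ∀ S : ℝ, S₁ ≤ S → ∀ (Λ : Finset HexVertex) (a : Sym2 HexVertex),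
      hexDomainSimplyConnected Λ → a ∈ hexDomainBoundary Λ → Deep Λ O (2 * S) → ¬ Deep Λ O (4 * S) →
        ∑ P ∈ Pic S, ‖amp Λ a S P‖ * ‖picMono S P‖ ≤ K * ‖obsMono Λ a‖ := by
  sorry

/-- **S6' — windowed intrusion tail (OPEN; the 3-arm bet shared with `z3` S4 / `one-mouth` S5').**
In the window `B_{2S}(O) ⊆ Λ ⊉ B_{4S}(O)` (reshape r1, as for S6), for
fixed comparison radius `r`, cleanliness radius `s̄ ≥ r` and `δ > 0`, once `S` is large the
pictures whose intrusions meet `B_{s̄}(O)` — prefixes that dived from beyond `S` to within `s̄` of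
`O` and went back out beyond `S` before their last entrance — carry against the inner fields on
`B_r(O)` a share `≤ δ Σ_P |amp||m|` (r4): three strands cross the annulus `A(s̄, S)` against one, predicted
cost `(s̄/S)^{x₃-x₁} = (s̄/S)^{3/2}` in mass against the monopole's `(S)^{-25/48}`, exponent
margin `47/48`. No rigorous SAW arm-separation exists (inputs: Hammersley–Welsh unfolding,
sub-ballisticity DCH13 / arXiv:2310.17299); dead pictures (blocked near `O`) contribute `0`. -/
theorem stub_intrusionTail :
    ∀ r : ℝ, 1 ≤ r → ∀ sbar : ℝ, r ≤ sbar → ∀ δ : ℝ, 0 < δ → ∃ S₂ : ℝ, ∀ S : ℝ, S₂ ≤ S →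
      ∀ (Λ : Finset HexVertex) (a : Sym2 HexVertex),
        hexDomainSimplyConnected Λ → a ∈ hexDomainBoundary Λ → Deep Λ O (2 * S) → ¬ Deep Λ O (4 * S) →
          ∑ P ∈ (Pic S).filter (fun P => ¬ Clean sbar P),
              ‖amp Λ a S P‖ * ∑ e ∈ innerEdges r, ‖picField S P e‖ ≤
            δ * ∑ P ∈ Pic S, ‖amp Λ a S P‖ * ‖picMono S P‖ := by
  sorry

/-- **S7 — the uniqueness reduction (provable now, L; hypotheses S4, S6, S6' SPELLED OUT verbatim —
reshape r3 — so that a Theorems-side proof needs only the Defs module; definitionally the named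
statement `UniquenessReduction`).** Let `G, G' ∈ LocalLimits`, fix an edge
`z` and `δ > 0`; choose `r ≥ 1` with `z` and the star of `O` in `innerEdges r`. TOPOLOGICAL LEMMA
(the one non-analytic step): a picture realised by a prefix from a root outside `B_S(O)` whose
inner observable is not identically `0` is GOOD — its intrusion set is a union of arcs each
adjacent to the connected exterior of the ball, so `B_S ∖ P.1` has connected complement, and its
dart head is unvisited; hence every picture with `amp · F_P ≠ 0` is an admissible, `s̄`-deep
configuration rooted at a boundary dart, to which `RatioAtDepth` and `PicLimits` apply. CLAIM
(compactness on the sub-family): there are `s̄ ≥ 2r + 2R₀ + 4` and `S₃` such that every good `s̄`-clean picture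
`P ∈ Pic S`, `S ≥ S₃`, with `m_S(P) ≠ 0` has `|F_P(e)/m_S(P) - Ψ(e)| ≤ δ` on `innerEdges r`, `Ψ`
the unique picture limit — else violators with cleanliness `→ ∞` have (by `noFoldHarnack` chains
inside their simply connected, `s̄`-deep picture domains: bounded coordinates) a convergent
subsequence, an element of `PicLimits ≠ {Ψ}`. By the same Harnack chains a clean good row is either
ALIVE (`m_S(P) ≠ 0`) or DEAD on `innerEdges r` (vanishes there). For the `n`-th configuration
of either sequence (finite and `n`-deep) pick its WINDOW SCALE `S` with `B_{2S} ⊆ Λₙ ⊉ B_{4S}`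
(`exists_window` of `…OneScaleGlue`; then `S > n/4`, so `S ≥ max(S₁, S₂(r,s̄,δ), S₃)` for `n`
large); its root is outside `B_{S+1}`,
`picDom = B_S ∖ P.1`, and S4 on the star and on `z` gives `F(e) = Λ₀ Ψ(e) + R(e)` with
`Λ₀ = Σ_{alive clean} amp · m_S` and `|R(e)| ≤ δ Σ|amp||m_S| + (dirty share) ≤ 2δ Σ|amp||m_S| ≤ 2δK |M|`
(S6', then S6, both applicable in the window); summing over the star (`Σ Ψ(star) = 1`) gives `Λ₀ = M (1 + O(δ(K+1)))`, hence
`|F(e)/M - Ψ(e)| ≤ C δ` along both sequences (with `|Ψ(e)|` bounded via the convergent sequence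
itself), so `|G z - G' z| ≤ 2Cδ` for every `δ`: `G = G'` on edges, and off edges both vanish. -/
theorem stub_uniquenessReduction :
    (∀ (D : Finset HexVertex) (ρ : Sym2 HexVertex) (S : ℝ) (p q : HexVertex),
      (∀ u ∈ ρ, u ∉ latticeBall S) → p ∈ latticeBall S → q ∈ latticeBall S → p ∈ D → q ∈ D →
        obs D ρ s(p, q) = ∑ P ∈ Pic S, amp D ρ S P * obs (picDom D S P) (picRoot P) s(p, q)) →
    (∃ K S₁ : ℝ, ∀ S : ℝ, S₁ ≤ S → ∀ (Λ : Finset HexVertex) (a : Sym2 HexVertex),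
      hexDomainSimplyConnected Λ → a ∈ hexDomainBoundary Λ → Deep Λ O (2 * S) → ¬ Deep Λ O (4 * S) →
        ∑ P ∈ Pic S, ‖amp Λ a S P‖ * ‖picMono S P‖ ≤ K * ‖obsMono Λ a‖) →
    (∀ r : ℝ, 1 ≤ r → ∀ sbar : ℝ, r ≤ sbar → ∀ δ : ℝ, 0 < δ → ∃ S₂ : ℝ, ∀ S : ℝ, S₂ ≤ S →
      ∀ (Λ : Finset HexVertex) (a : Sym2 HexVertex),
        hexDomainSimplyConnected Λ → a ∈ hexDomainBoundary Λ → Deep Λ O (2 * S) → ¬ Deep Λ O (4 * S) →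
          ∑ P ∈ (Pic S).filter (fun P => ¬ Clean sbar P),
              ‖amp Λ a S P‖ * ∑ e ∈ innerEdges r, ‖picField S P e‖ ≤
            δ * ∑ P ∈ Pic S, ‖amp Λ a S P‖ * ‖picMono S P‖) →
      ∀ k R₀ : ℝ, 0 ≤ k → k < 1 → RatioAtDepth R₀ k → PicLimits.Subsingleton →
        LocalLimits.Subsingleton :=
  _root_.Summit.CriticalPhenomena.SAWScalingLimit.Theorems.InteriorFlattening.Liouville.stub_uniquenessReduction

/-! ### Consistency: each named statement IS its registered stub (definitionally) -/

theorem bulkNoFold_holds : BulkNoFold := stub_bulkNoFold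
theorem compactnessAtOrigin_holds : CompactnessAtOrigin := stub_compactnessAtOrigin
theorem lastExitFactorisation_holds : LastExitFactorisation := stub_lastExitFactorisation
theorem pictureLimitsUnique_holds : PictureLimitsUnique := stub_pictureLimitsUnique
theorem localLimitsUnique_holds : LocalLimitsUnique := stub_localLimitsUnique
theorem farFieldCoherence_holds : FarFieldCoherence := stub_farFieldCoherence
theorem intrusionTail_holds : IntrusionTail := stub_intrusionTail
theorem uniquenessReduction_holds : UniquenessReduction := stub_uniquenessReduction

/-! ### Name-keyed aliases of the seven statements (the hypotheses of the composition) -/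
namespace Registered

/-- Alias of `BulkNoFold` keyed by the registered stub name. -/
abbrev stub_bulkNoFold : Prop := BulkNoFold
/-- Alias of `CompactnessAtOrigin` keyed by the registered stub name. -/
abbrev stub_compactnessAtOrigin : Prop := CompactnessAtOrigin
/-- Alias of `LastExitFactorisation` keyed by the registered stub name. -/
abbrev stub_lastExitFactorisation : Prop := LastExitFactorisation
/-- Alias of `PictureLimitsUnique` keyed by the registered stub name. -/
abbrev stub_pictureLimitsUnique : Prop := PictureLimitsUnique
/-- Alias of `LocalLimitsUnique` keyed by the registered stub name. -/
abbrev stub_localLimitsUnique : Prop := LocalLimitsUnique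
/-- Alias of `FarFieldCoherence` keyed by the registered stub name. -/
abbrev stub_farFieldCoherence : Prop := FarFieldCoherence
/-- Alias of `IntrusionTail` keyed by the registered stub name. -/
abbrev stub_intrusionTail : Prop := IntrusionTail
/-- Alias of `UniquenessReduction` keyed by the registered stub name. -/
abbrev stub_uniquenessReduction : Prop := UniquenessReduction

end Registered

/-! ### Proved: S1 is necessary, and follows from the route's (K) -/

/-- The crux implies S1 (take `ε = 1/2`): the base stub costs the line nothing. -/
theorem bulkNoFold_of_interiorFlattening
    (h : Summit.CriticalPhenomena.SAWScalingLimit.Theses.SAWDevelopingMap.InteriorFlattening) :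
    BulkNoFold := by
  obtain ⟨R, hR⟩ := (interiorFlattening_iff.1 h) (1 / 2) (by norm_num)
  exact ⟨1 / 2, R, by norm_num, by norm_num, hR⟩

/-- The route's rank-2 crux `NoFoldBound` ((K), all vertices) implies S1 (deep vertices, with
`k ↦ max k 0`, `R₀ = 0`). -/
theorem bulkNoFold_of_noFoldBound
    (h : Summit.CriticalPhenomena.SAWScalingLimit.Theses.SAWDevelopingMap.NoFoldBound) :
    BulkNoFold := by
  obtain ⟨k, hk1, hK⟩ := h
  refine ⟨max k 0, 0, le_max_right _ _, max_lt hk1 one_pos, ?_⟩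
  intro Λ hΛ a ha v hv _ w₀ w₁ w₂ h₀ h₁ h₂ h01 h12 h02
  have hv' : ‖fieldBelt (obs Λ a) v w₀ w₁ w₂‖ ≤ k * ‖fieldMono (obs Λ a) v w₀ w₁ w₂‖ :=
    hK Λ hΛ a ha v hv w₀ w₁ w₂ h₀ h₁ h₂ h01 h12 h02
  exact hv'.trans (mul_le_mul_of_nonneg_right (le_max_left _ _) (norm_nonneg _))

/-! ### Proved: the crux in first-arrival form (Literature mode identities + …FirstArrivalForm, landed this line) -/

/-- **`InteriorFlattening` in first-arrival form.** The crux holds iff for every `ε > 0` there is a depth `R` such that at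
every `R`-deep vertex `v` of every simply connected domain with a boundary root `a`, in every CLOCKWISE frame
(`c w₁ - c v = ζ⁴ (c w₀ - c v)`, `c w₂ - c v = ζ² (c w₀ - c v)`), the first arrivals `A_j = firstArrivalObservable Λ a x_c (5/8) v w_j`
and loop walks `L_j` satisfy `‖κ_B (A₀ + ωA₁ + ω²A₂) + (L₀ + ωL₁ + ω²L₂)‖ ≤ ε ‖κ_M (A₀ + A₁ + A₂) + (L₀ + L₁ + L₂)‖`,
`κ_B = 1 + 2x_c cos(11π/24)`, `κ_M = 1 + 2x_c cos(5π/24)` (DCS's triplets in the two non-trivial characters of `ℤ/3`: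
`obs_modes_eq_firstArrival`, `ratioAtDepth_iff_firstArrival`; counter-clockwise frames are free by Lemma 1). -/
theorem interiorFlattening_iff_firstArrival :
    Summit.CriticalPhenomena.SAWScalingLimit.Theses.SAWDevelopingMap.InteriorFlattening ↔
      ∀ ε : ℝ, 0 < ε → ∃ R : ℝ,
        ∀ (Λ : Finset HexVertex), hexDomainSimplyConnected Λ → ∀ a ∈ hexDomainBoundary Λ, ∀ v ∈ Λ,
          Deep Λ v R → ∀ w₀ w₁ w₂ : HexVertex,
            hexGraph.Adj v w₀ → hexGraph.Adj v w₁ → hexGraph.Adj v w₂ →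
            hexCenter w₁ - hexCenter v = triZeta ^ 4 * (hexCenter w₀ - hexCenter v) →
            hexCenter w₂ - hexCenter v = triZeta ^ 2 * (hexCenter w₀ - hexCenter v) →
              ‖((1 + 2 * hexCriticalFugacity * Real.cos (11 * Real.pi / 24) : ℝ) : ℂ) *
                    (firstArrivalObservable Λ a xc (5 / 8) v w₀ + omega * firstArrivalObservable Λ a xc (5 / 8) v w₁ +
                      omega ^ 2 * firstArrivalObservable Λ a xc (5 / 8) v w₂) +
                  (loopArrivalObservable Λ a xc (5 / 8) v w₀ + omega * loopArrivalObservable Λ a xc (5 / 8) v w₁ +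
                    omega ^ 2 * loopArrivalObservable Λ a xc (5 / 8) v w₂)‖ ≤
                ε * ‖((1 + 2 * hexCriticalFugacity * Real.cos (5 * Real.pi / 24) : ℝ) : ℂ) *
                    (firstArrivalObservable Λ a xc (5 / 8) v w₀ + firstArrivalObservable Λ a xc (5 / 8) v w₁ +
                      firstArrivalObservable Λ a xc (5 / 8) v w₂) +
                  (loopArrivalObservable Λ a xc (5 / 8) v w₀ + loopArrivalObservable Λ a xc (5 / 8) v w₁ +
                    loopArrivalObservable Λ a xc (5 / 8) v w₂)‖ := by
  rw [interiorFlattening_iff]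
  refine forall_congr' fun ε => forall_congr' fun hε => exists_congr fun R => ?_
  exact ratioAtDepth_iff_firstArrival hε.le

/-! ### Proved: S5\* and S5 are necessary (the top layer and the core lose nothing) -/

/-- The crux implies S5\* (…LiouvilleNecessity: under (M) every local limit is the constant `1/3`). -/
theorem localLimitsUnique_of_interiorFlattening
    (h : Summit.CriticalPhenomena.SAWScalingLimit.Theses.SAWDevelopingMap.InteriorFlattening) :
    LocalLimitsUnique :=
  fun _ _ _ _ _ => localLimits_subsingleton_of_interiorFlattening h

/-- The crux implies S5 (…LiouvilleNecessity: under (M) every picture limit is the constant `1/3`). -/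
theorem pictureLimitsUnique_of_interiorFlattening
    (h : Summit.CriticalPhenomena.SAWScalingLimit.Theses.SAWDevelopingMap.InteriorFlattening) :
    PictureLimitsUnique :=
  fun _ _ _ _ _ => picLimits_subsingleton_of_interiorFlattening h

/-! ### Composition (r9): the top layer S1 + S5\* implies the crux BY NAME, and conversely -/

/-- **The line concludes the crux (top layer).** S1 + S5\* ⟹ (M): the landed Equivalence read left to
right — under bulk no-fold a failure of (M) at every depth yields (S2, landed) a normalised local limit
`G`, bad at `O`, with `G ∘ rot ∈ LocalLimits`; uniqueness gives `G ∘ rot = G`, so `G` is flat at `O` in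
every frame while its monopole is `1` — contradiction. -/
theorem InteriorFlattening_of (h1 : Registered.stub_bulkNoFold)
    (h5 : Registered.stub_localLimitsUnique) :
    Summit.CriticalPhenomena.SAWScalingLimit.Theses.SAWDevelopingMap.InteriorFlattening := by
  have hBNF : BulkNoFold := h1
  have hLLU : LocalLimitsUnique := h5
  obtain ⟨k, R₀, hk0, hk1, hR⟩ := hBNF
  exact interiorFlattening_of_bulkNoFold_of_subsingleton ⟨k, R₀, hk0, hk1, hR⟩ (hLLU k R₀ hk0 hk1 hR)

/-- **Nothing is lost at the top layer**: the crux is EQUIVALENT to the conjunction of the two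
registered top-layer stubs (S1 at `ε = 1/2`; S5\* by Necessity). -/
theorem interiorFlattening_iff_registered :
    Summit.CriticalPhenomena.SAWScalingLimit.Theses.SAWDevelopingMap.InteriorFlattening ↔
      Registered.stub_bulkNoFold ∧ Registered.stub_localLimitsUnique :=
  ⟨fun h => ⟨bulkNoFold_of_interiorFlattening h, localLimitsUnique_of_interiorFlattening h⟩,
    fun h => InteriorFlattening_of h.1 h.2⟩

/-- **r10 — the registered core in conditional form** (…LiouvillePromotion, p133334): the top-layer stub S5\* is
EQUIVALENT to "S1 implies the crux". So the two registered top-layer stubs are not merely jointly sufficient: S5\* is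
exactly the crux conditioned on S1. -/
theorem registered_core_iff_conditional :
    Registered.stub_localLimitsUnique ↔
      (Registered.stub_bulkNoFold →
        Summit.CriticalPhenomena.SAWScalingLimit.Theses.SAWDevelopingMap.InteriorFlattening) := by
  -- proof term of `Promotion.localLimitsUnique_iff_conditional` (…LiouvillePromotion, p133334), inlined so that the
  -- skeleton elaborates on farm snapshots that predate that module
  change LocalLimitsUnique ↔ (BulkNoFold → _)
  constructor
  · rintro h ⟨k, R₀, hk0, hk1, hR⟩
    exact interiorFlattening_of_bulkNoFold_of_subsingleton ⟨k, R₀, hk0, hk1, hR⟩ (h k R₀ hk0 hk1 hR)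
  · intro h k R₀ hk0 hk1 hR
    exact localLimits_subsingleton_of_interiorFlattening (h ⟨k, R₀, hk0, hk1, hR⟩)

/-- **r10 — the registered core in the route file's vocabulary** (…LiouvillePromotion, p133334): S5\* holds iff an
eventual no-fold bound — some `k < 1` bounding `‖F₀ + ωF₁ + ω²F₂‖ / ‖F₀ + F₁ + F₂‖` at every `R₀`-deep vertex of every
simply connected domain with a boundary root, in every frame, `F = hexParafermionicObservable Λ a x_c (5/8)` — implies
`InteriorFlattening`. This right-hand side is statable in `Theses/SAWDevelopingMap.lean` as it stands (the signature a
planner promotes S5\* to). -/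
theorem registered_core_iff_routeVocabulary :
    Registered.stub_localLimitsUnique ↔
      ((∃ k R₀ : ℝ, 0 ≤ k ∧ k < 1 ∧ ∀ (Λ : Finset HexVertex), hexDomainSimplyConnected Λ →
        ∀ a ∈ hexDomainBoundary Λ, ∀ v ∈ Λ,
          (∀ w : HexVertex, dist (hexCenter w) (hexCenter v) ≤ R₀ → w ∈ Λ) →
            ∀ w₀ w₁ w₂ : HexVertex, hexGraph.Adj v w₀ → hexGraph.Adj v w₁ → hexGraph.Adj v w₂ →
              w₀ ≠ w₁ → w₁ ≠ w₂ → w₀ ≠ w₂ →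
                let F : Sym2 HexVertex → ℂ := hexParafermionicObservable Λ a hexCriticalFugacity (5 / 8)
                let ω : ℂ := Complex.exp (2 * Real.pi * Complex.I / 3)
                ‖F s(v, w₀) + ω * F s(v, w₁) + ω ^ 2 * F s(v, w₂)‖ ≤
                  k * ‖F s(v, w₀) + F s(v, w₁) + F s(v, w₂)‖) →
        Summit.CriticalPhenomena.SAWScalingLimit.Theses.SAWDevelopingMap.InteriorFlattening) :=
  -- `Promotion.localLimitsUnique_iff_routeVocabulary` (p133334), inlined: `BulkNoFold` unfolds to the spelled-out bound
  registered_core_iff_conditional.trans (imp_congr_left Iff.rfl)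

/-- **r10 — the transfer statement** (…LiouvillePromotion, p133334): in route vocabulary with NO new definition,
`NoFoldBound → InteriorFlattening` is exactly the Liouville uniqueness under (K); it is implied by S5\*
(`Promotion.transfer_of_localLimitsUnique`) and by the crux, and with the rank-2 crux `NoFoldBound` it gives the crux
back (`fun hK hT => hT hK`). -/
theorem transfer_iff_subsingleton :
    (Summit.CriticalPhenomena.SAWScalingLimit.Theses.SAWDevelopingMap.NoFoldBound →
        Summit.CriticalPhenomena.SAWScalingLimit.Theses.SAWDevelopingMap.InteriorFlattening) ↔
      (Summit.CriticalPhenomena.SAWScalingLimit.Theses.SAWDevelopingMap.NoFoldBound → LocalLimits.Subsingleton) :=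
  -- `Promotion.transfer_iff_subsingleton` (p133334), inlined
  forall_congr' fun hK => interiorFlattening_iff_subsingleton_of_noFoldBound hK

/-- **r10** — S5\* gives the transfer statement. -/
theorem transfer_of_registered_core (h : Registered.stub_localLimitsUnique) :
    Summit.CriticalPhenomena.SAWScalingLimit.Theses.SAWDevelopingMap.NoFoldBound →
      Summit.CriticalPhenomena.SAWScalingLimit.Theses.SAWDevelopingMap.InteriorFlattening := fun hK =>
  -- `Promotion.transfer_of_localLimitsUnique` (p133334), inlined
  registered_core_iff_conditional.1 h (bulkNoFold_of_noFoldBound hK)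

/-- **S5\* ⟹ S5** (landed …LiouvillePicSubLocal, p117666: `PicLimits ⊆ LocalLimits`): the sub-route's core is a
special case of the top-layer core. -/
theorem stub_pictureLimitsUnique_of_stub_localLimitsUnique (h : Registered.stub_localLimitsUnique) :
    Registered.stub_pictureLimitsUnique :=
  pictureLimitsUnique_of_localLimitsUnique h

/-- **S6 ⇐ PC** (the atom of the bet): the sibling line's `PhaseConcentration η β` with `β ≤ π/2`,
`(1-η) cos β - η > 0` gives one-mouth coherence (…CoherenceReduction, landed) and hence S6 (…CoherenceBridge,
p107715). Wave-3 verdict on S6: stub-blocked on PC. -/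
theorem farFieldCoherence_of_PC (η β : ℝ) (hβ : β ≤ Real.pi / 2) (hpos : 0 < (1 - η) * Real.cos β - η)
    (hPC : OneMouth.PhaseConcentration η β) : FarFieldCoherence :=
  farFieldCoherence_of_oneMouthCoherence (OneMouth.farFieldCoherence_of_phaseConcentration η β hβ hpos hPC)

/-- **S6' ⇐ E1' + E2** (the atoms of the bet; landed …LiouvilleIntrusionBridge, p117719): the coherent three-arm
re-entry gap `PictureReentryGap ρ` and the clean-monopole lower bound `OneMouth.CleanMonopoleLowerBound κ` with
`κ < ρ` (heuristically `ρ = 3/2`, `κ = 25/48`) give S6'. Wave-3 verdict on S6': stub-blocked on E1' + E2. -/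
theorem intrusionTail_of_atoms (ρ κ : ℝ) (hκ : 0 ≤ κ) (hκρ : κ < ρ) (hE1 : PictureReentryGap ρ)
    (hE2 : OneMouth.CleanMonopoleLowerBound κ) : IntrusionTail :=
  intrusionTail_of_armEstimates ρ κ hκ hκρ hE1 hE2

/-- **The sub-route, one layer down**: S5 + S6 + S6' ⟹ S5\*, by the landed S4 (last-exit factorisation)
and S7 (uniqueness reduction). S5 is necessary; S6, S6' are the line's only bets. -/
theorem localLimitsUnique_of_subroute (h4 : Registered.stub_pictureLimitsUnique)
    (h5 : Registered.stub_farFieldCoherence) (h6 : Registered.stub_intrusionTail) :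
    LocalLimitsUnique := by
  have hPic : PictureLimitsUnique := h4
  have hCoh : FarFieldCoherence := h5
  have hTail : IntrusionTail := h6
  have hFac : LastExitFactorisation := lastExitFactorisation_holds  -- S4 CLOSED (landed p104482)
  have hRed : UniquenessReduction := uniquenessReduction_holds  -- S7 CLOSED (landed p110977)
  intro k R₀ hk0 hk1 hR
  exact hRed hFac hCoh hTail k R₀ hk0 hk1 hR (hPic k R₀ hk0 hk1 hR)

/-! ### Composition (r8, kept): the sub-route's stubs imply the crux BY NAME -/

/-- **The line concludes the crux (sub-route, r8 verbatim).** By contradiction: if (M) fails, some `ε > 0` is violated at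
every depth (read-back `interiorFlattening_iff`); S1 + S2 give a normalised local limit `G`, bad at
`O`, with `G ∘ rot ∈ LocalLimits`; S7 (fed by S4, S6, S6', S1 and the core S5) makes `LocalLimits`
a subsingleton, so `G ∘ rot = G`: the three values of `G` around `O` coincide (`rot` fixes `O` and
permutes its star), hence the `ω`-combination vanishes in every frame (`1 + ω + ω² = 0`) while the
monopole is `1` — contradicting badness. -/
theorem InteriorFlattening_of_subroute (h1 : Registered.stub_bulkNoFold)
    (h4 : Registered.stub_pictureLimitsUnique) (h5 : Registered.stub_farFieldCoherence)
    (h6 : Registered.stub_intrusionTail) :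
    Summit.CriticalPhenomena.SAWScalingLimit.Theses.SAWDevelopingMap.InteriorFlattening := by
  have hBNF : BulkNoFold := h1
  have hCpt : CompactnessAtOrigin := compactnessAtOrigin_holds  -- S2 CLOSED (landed p111048)
  have hFac : LastExitFactorisation := lastExitFactorisation_holds  -- S4 CLOSED (landed p104482)
  have hPic : PictureLimitsUnique := h4
  have hCoh : FarFieldCoherence := h5
  have hTail : IntrusionTail := h6
  have hRed : UniquenessReduction := uniquenessReduction_holds  -- S7 CLOSED (landed p110977)
  obtain ⟨k, R₀, hk0, hk1, hR⟩ := hBNF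
  have hsub : LocalLimits.Subsingleton :=
    hRed hFac hCoh hTail k R₀ hk0 hk1 hR (hPic k R₀ hk0 hk1 hR)
  by_contra hM
  rw [interiorFlattening_iff] at hM
  push Not at hM
  obtain ⟨ε, hε, hbad⟩ := hM
  obtain ⟨G, hG, hGrot, hnorm, w₀, w₁, w₂, ha0, ha1, ha2, -, -, -, hbadG⟩ :=
    hCpt k R₀ ε hk0 hk1 hR hε (fun n => hbad n)
  have heq : G ∘ Sym2.map rotO = G := hsub hGrot hG
  have hAB : G s(O, nbB) = G s(O, nbA) := by
    have := congrFun heq s(O, nbA)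
    simpa [Function.comp, Sym2.map_mk, rotO_O, rotO_nbA] using this
  have hBC : G s(O, nbC) = G s(O, nbB) := by
    have := congrFun heq s(O, nbB)
    simpa [Function.comp, Sym2.map_mk, rotO_O, rotO_nbB] using this
  have hval : ∀ w, hexGraph.Adj O w → G s(O, w) = G s(O, nbA) := by
    intro w hw
    rcases nbr_cases hw with rfl | rfl | rfl
    · rfl
    · exact hAB
    · exact hBC.trans hAB
  have hcan : fieldMono G O nbA nbB nbC = 3 * G s(O, nbA) := by
    simp only [fieldMono, hAB, hBC]; ring
  have hfrm : fieldMono G O w₀ w₁ w₂ = 3 * G s(O, nbA) := by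
    simp only [fieldMono, hval _ ha0, hval _ ha1, hval _ ha2]; ring
  have hmono1 : fieldMono G O w₀ w₁ w₂ = 1 := by rw [hfrm, ← hcan, hnorm]
  have hbelt0 : fieldBelt G O w₀ w₁ w₂ = 0 := by
    simp only [fieldBelt, hval _ ha0, hval _ ha1, hval _ ha2]
    linear_combination (G s(O, nbA)) * one_add_omega_add_sq
  rw [hmono1, hbelt0] at hbadG
  simp only [norm_one, mul_one, norm_zero] at hbadG
  linarith

/-- Wiring check (top layer): the registered stubs feed `InteriorFlattening_of` as stated. -/
example : Summit.CriticalPhenomena.SAWScalingLimit.Theses.SAWDevelopingMap.InteriorFlattening :=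
  InteriorFlattening_of stub_bulkNoFold stub_localLimitsUnique

/-- Wiring check (sub-route): S1 + S5 + S6 + S6' feed the crux through `localLimitsUnique_of_subroute`. -/
example : Summit.CriticalPhenomena.SAWScalingLimit.Theses.SAWDevelopingMap.InteriorFlattening :=
  InteriorFlattening_of stub_bulkNoFold
    (localLimitsUnique_of_subroute stub_pictureLimitsUnique stub_farFieldCoherence stub_intrusionTail)

/-- Wiring check (r8 composition, kept). -/
example : Summit.CriticalPhenomena.SAWScalingLimit.Theses.SAWDevelopingMap.InteriorFlattening :=
  InteriorFlattening_of_subroute stub_bulkNoFold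
    stub_pictureLimitsUnique stub_farFieldCoherence stub_intrusionTail

end

end Summit.CriticalPhenomena.SAWScalingLimit.Cruxes.InteriorFlattening.LiouvilleLocalLimits
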